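import Summits.RiemannHypothesis.RiemannHypothesis.Theorems.WeilWindowFlowWindowLipschitzStubBarrierWeakFormAux
import Mathlib.MeasureTheory.Integral.Prod

/-!
# Stub `stub_barrierWeakForm` (line `borderline-barrier`, crux `WeilWindowFlow.WindowLipschitz`)

The weak (Fubini) form of the surplus of the explicit two-scale barrier
`B(x) = (log(1/min(a − |x|, d₀)))^{-1/2}` on the window `(-a, a)` (`0` outside): if at every
point `y` of the edge layer `a − d₀ < |y| < a` the integrand of the archimedean jump operator
`(L B)(y) = ∫₀^∞ (2B(y) − B(y+t) − B(y−t)) ρ(t) dt` (`ρ = weilArchDensity`) is integrable and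
`(L B)(y) ≥ c`, then for every real test function `w ∈ L²`, `w ≥ 0` a.e., `w = 0` a.e. off the
layer,
`c ∫ w ≤ ∫₀^∞ ρ(t) ∫ (B(x+t) − B x)(w(x+t) − w x) dx dt`.

Proof: for each `t`, translation invariance gives
`∫ (B(x+t) − B x)(w(x+t) − w x) dx = ∫ w(x)(2B x − B(x+t) − B(x−t)) dx`; the function
`F(x,t) = w(x)(2B x − B(x+t) − B(x−t))ρ(t)` is integrable on `ℝ × (0,∞)` because
`Φ(x) = ∫₀^∞ |2B x − B(x+t) − B(x−t)| ρ(t) dt ≤ 8 + 2β₀ (log(2/(a − |x|)) + ∫_{Ioi 1} ρ)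
 ≤ C (a − |x|)^{-1/4}` on the layer (the local Lipschitz bound of `B` handles `t ≤ d/2`
against `ρ ≤ 1/t`, the bound `|·| ≤ 2β₀` the range `t > d/2` against
`∫_{Ioi (d/2)} ρ ≤ log(2/d) + ∫_{Ioi 1} ρ`), and `|w| (a − |x|)^{-1/4} ≤ (w² + (a − |x|)^{-1/2})/2`
is integrable on the layer; Fubini then gives `RHS = ∫ w · (L B) ≥ c ∫ w`.

## References

* H. Chen, T. Weth, *The Dirichlet problem for the logarithmic Laplacian*, Comm. PDE 44 (2019),
  arXiv:1710.03416, §3 (weak form of `L_Δ` on barriers).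
-/

set_option linter.dupNamespace false

noncomputable section

open MeasureTheory Set Filter
open scoped Topology ENNReal NNReal

namespace Summit.RiemannHypothesis.RiemannHypothesis.Theorems.WeilWindowFlowWindowLipschitz

open Literature.NumberTheory.LFunctions

/-! ## The jump operator of the barrier: an `L¹` bound on the layer -/

/-- **Pointwise bound for `Φ(x) = ∫₀^∞ |2B x − B(x+t) − B(x−t)| ρ(t) dt` on the layer**:
`Φ(x) ≤ 8 + 2β₀ (log(2/d) + ∫_{Ioi 1} ρ)`, `d = a − |x|` (small `t ≤ d/2`: local Lipschitz
bound `16 t/d` against `ρ ≤ 1/t`; `t > d/2`: `|·| ≤ 2β₀` against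
`∫_{Ioi (d/2)} ρ ≤ log(2/d) + ∫_{Ioi 1} ρ`). [folklore] -/
theorem stub_barrierWeakForm_Phi_le {a d₀ : ℝ} {B : ℝ → ℝ} (hd₀ : 0 < d₀) (h2d₀ : 2 * d₀ ≤ 1)
    (hB : ∀ x, B x = if |x| < a then 1 / Real.sqrt (Real.log (1 / min (a - |x|) d₀)) else 0)
    {x : ℝ} (hx1 : a - d₀ < |x|) (hx2 : |x| < a)
    (hI : IntegrableOn (fun t ↦ (2 * B x - B (x + t) - B (x - t)) * weilArchDensity t) (Ioi 0)) :
    ∫ t in Ioi (0 : ℝ), |(2 * B x - B (x + t) - B (x - t)) * weilArchDensity t| ≤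
      8 + 2 * (1 / Real.sqrt (Real.log (1 / d₀))) *
        (Real.log (2 / (a - |x|)) + ∫ t in Ioi 1, weilArchDensity t) := by
  set d := a - |x| with hd_def
  set β₀ := 1 / Real.sqrt (Real.log (1 / d₀)) with hβ₀
  set f : ℝ → ℝ := fun t ↦ (2 * B x - B (x + t) - B (x - t)) * weilArchDensity t with hf
  have hd : 0 < d := by
    rw [hd_def]
    linarith
  have hdd₀ : d < d₀ := by
    rw [hd_def]
    linarith
  have hβ₀0 : 0 ≤ β₀ := by positivity
  have hfI : IntegrableOn (fun t ↦ |f t|) (Ioi 0) := hI.abs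
  have hsplit : ∫ t in Ioi 0, |f t| =
      (∫ t in Ioc 0 (d / 2), |f t|) + ∫ t in Ioi (d / 2), |f t| := by
    rw [← setIntegral_union Ioc_disjoint_Ioi_same measurableSet_Ioi
      (hfI.mono_set Ioc_subset_Ioi_self) (hfI.mono_set (Ioi_subset_Ioi (by positivity))),
      Ioc_union_Ioi_eq_Ioi (by positivity)]
  -- the near piece `t ∈ (0, d/2]`
  have h1 : ∫ t in Ioc 0 (d / 2), |f t| ≤ 8 := by
    have hb : ∀ t ∈ Ioc 0 (d / 2), |f t| ≤ 16 / d := by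
      intro t ht
      have ht1 : t ≤ 1 := by linarith [ht.2]
      have ht0 : t ≠ 0 := ht.1.ne'
      have hρ := stub_commutatorBound_rho_le_inv ht.1 ht1
      have hρ0 := weilArchDensity_pos ht.1
      have hp : |B (x + t) - B x| ≤ 8 * t / d :=
        stub_barrierWeakForm_B_lip h2d₀ hB hx1 hx2
          (by rw [add_sub_cancel_left, abs_of_pos ht.1]) ht.2
      have hm : |B (x - t) - B x| ≤ 8 * t / d :=
        stub_barrierWeakForm_B_lip h2d₀ hB hx1 hx2
          (by rw [sub_sub_cancel_left, abs_neg, abs_of_pos ht.1]) ht.2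
      have hK : |2 * B x - B (x + t) - B (x - t)| ≤ 16 * t / d := by
        have e : 2 * B x - B (x + t) - B (x - t) =
            -((B (x + t) - B x) + (B (x - t) - B x)) := by
          ring
        rw [e, abs_neg]
        calc |(B (x + t) - B x) + (B (x - t) - B x)|
            ≤ |B (x + t) - B x| + |B (x - t) - B x| := abs_add_le _ _
          _ ≤ 8 * t / d + 8 * t / d := add_le_add hp hm
          _ = 16 * t / d := by ring
      simp only [hf]
      rw [abs_mul, abs_of_pos hρ0]
      calc |2 * B x - B (x + t) - B (x - t)| * weilArchDensity t
          ≤ (16 * t / d) * (1 / t) :=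
            mul_le_mul hK hρ hρ0.le (div_nonneg (by linarith [ht.1]) hd.le)
        _ = 16 / d := by
            field_simp
    calc ∫ t in Ioc 0 (d / 2), |f t| ≤ ∫ t in Ioc 0 (d / 2), (16 / d : ℝ) :=
          setIntegral_mono_on (hfI.mono_set Ioc_subset_Ioi_self)
            (integrableOn_const (by rw [Real.volume_Ioc]; exact ENNReal.ofReal_ne_top))
            measurableSet_Ioc hb
      _ = 8 := by
          rw [setIntegral_const, Real.volume_real_Ioc_of_le (by positivity), smul_eq_mul]
          field_simp
          ring
  -- the far piece `t > d/2`
  have h2 : ∫ t in Ioi (d / 2), |f t| ≤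
      2 * β₀ * (Real.log (2 / d) + ∫ t in Ioi 1, weilArchDensity t) := by
    have hρI : IntegrableOn weilArchDensity (Ioi (d / 2)) :=
      integrableOn_weilArchDensity_Ioi (by positivity)
    have hb : ∀ t ∈ Ioi (d / 2), |f t| ≤ 2 * β₀ * weilArchDensity t := by
      intro t ht
      have ht0 : 0 < t := lt_trans (by positivity) ht
      simp only [hf]
      rw [abs_mul, abs_of_pos (weilArchDensity_pos ht0)]
      exact mul_le_mul_of_nonneg_right (stub_barrierWeakForm_K_bound hd₀ h2d₀ hB x t)
        (weilArchDensity_pos ht0).le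
    calc ∫ t in Ioi (d / 2), |f t| ≤ ∫ t in Ioi (d / 2), 2 * β₀ * weilArchDensity t :=
          setIntegral_mono_on (hfI.mono_set (Ioi_subset_Ioi (by positivity))) (hρI.const_mul _)
            measurableSet_Ioi hb
      _ = 2 * β₀ * ∫ t in Ioi (d / 2), weilArchDensity t := integral_const_mul _ _
      _ ≤ 2 * β₀ * (Real.log (1 / (d / 2)) + ∫ t in Ioi 1, weilArchDensity t) :=
          mul_le_mul_of_nonneg_left (stub_barrierWeakForm_rho_tail (by positivity) (by linarith))
            (by positivity)
      _ = 2 * β₀ * (Real.log (2 / d) + ∫ t in Ioi 1, weilArchDensity t) := by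
          rw [one_div_div]
  linarith [hsplit, h1, h2]

/-! ## The weak form -/

/-- **Stub S2b `stub_barrierWeakForm` — the weak (Fubini) form of the surplus.** If at every
point `y` of the layer `a − d₀ < |y| < a` the integrand of
`(L B)(y) = ∫₀^∞ (2B(y) − B(y+t) − B(y−t))ρ(t)dt` is integrable and `(L B)(y) ≥ c`, then for
every `w ∈ L²`, `w ≥ 0` a.e., `w = 0` a.e. off the layer:
`c ∫ w ≤ ∫₀^∞ ρ(t) ∫ (B(x+t) − B x)(w(x+t) − w x) dx dt`. Proof: the per-`t` identity
`stub_barrierWeakForm_perT`, integrability of `F(x,t) = w(x)(2B x − B(x+t) − B(x−t))ρ(t)` on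
`ℝ × (0,∞)` (`integrable_prod_iff` with the layer bound `stub_barrierWeakForm_Phi_le` and
`|w| Φ ≤ (C/2)(w² + (a − |x|)^{-1/2})`), and Fubini (`integral_prod`, `integral_prod_symm`).
Sources: Chen–Weth arXiv:1710.03416 §3 (weak form of `L_Δ` on barriers). -/
theorem stub_barrierWeakForm :
    ∀ (a d₀ c : ℝ) (B : ℝ → ℝ), 0 < d₀ → 2 * d₀ ≤ 1 → d₀ < a →
      (∀ x, B x = if |x| < a then 1 / Real.sqrt (Real.log (1 / min (a - |x|) d₀)) else 0) →
      (∀ y : ℝ, a - d₀ < |y| → |y| < a →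
        IntegrableOn (fun t ↦ (2 * B y - B (y + t) - B (y - t)) * weilArchDensity t) (Ioi 0) ∧
          c ≤ ∫ t in Ioi (0 : ℝ), (2 * B y - B (y + t) - B (y - t)) * weilArchDensity t) →
      ∀ w : ℝ → ℝ, MemLp w 2 → (∀ᵐ x : ℝ, 0 ≤ w x) →
        (∀ᵐ x : ℝ, ¬(a - d₀ < |x| ∧ |x| < a) → w x = 0) →
        c * ∫ x, w x ≤
          ∫ t in Ioi (0 : ℝ), weilArchDensity t * ∫ x, (B (x + t) - B x) * (w (x + t) - w x) := by
  intro a d₀ c B hd₀ h2d₀ hd₀a hB hS w hw hw0 hoff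
  have hBm : Measurable B := stub_barrierWeakForm_B_measurable hB
  set β₀ := 1 / Real.sqrt (Real.log (1 / d₀)) with hβ₀
  have hBb : ∀ x, 0 ≤ B x ∧ B x ≤ β₀ := stub_barrierWeakForm_B_bounds hd₀ h2d₀ hB
  have hβ₀0 : 0 ≤ β₀ := by positivity
  -- `w` is integrable (`L²` on the bounded window, a.e. zero off it)
  have hwI : Integrable w := by
    refine IntegrableOn.integrable_of_ae_notMem_eq_zero (s := Icc (-a) a)
      ((hw.restrict (Icc (-a) a)).integrable one_le_two) ?_
    filter_upwards [hoff] with x hx hxS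
    refine hx fun hl ↦ hxS ?_
    exact ⟨by linarith [neg_abs_le x, hl.2], by linarith [le_abs_self x, hl.2]⟩
  -- the product integrand `F(x,t) = w(x) (2B x − B(x+t) − B(x−t)) ρ(t)` on `ℝ × (0,∞)`
  set ν : Measure ℝ := volume.restrict (Ioi 0) with hν
  set F : ℝ × ℝ → ℝ := fun p ↦
    w p.1 * ((2 * B p.1 - B (p.1 + p.2) - B (p.1 - p.2)) * weilArchDensity p.2) with hF
  have hFm : AEStronglyMeasurable F (volume.prod ν) := by
    refine (hw.1.comp_fst).mul (Measurable.aestronglyMeasurable ?_)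
    have h1 : Measurable fun p : ℝ × ℝ ↦ B (p.1 + p.2) :=
      hBm.comp (measurable_fst.add measurable_snd)
    have h2 : Measurable fun p : ℝ × ℝ ↦ B (p.1 - p.2) :=
      hBm.comp (measurable_fst.sub measurable_snd)
    have h3 : Measurable fun p : ℝ × ℝ ↦ B p.1 := hBm.comp measurable_fst
    have h4 : Measurable fun p : ℝ × ℝ ↦ weilArchDensity p.2 :=
      measurable_weilArchDensity.comp measurable_snd
    exact (((h3.const_mul 2).sub h1).sub h2).mul h4
  set I₁ := ∫ t in Ioi 1, weilArchDensity t with hI₁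
  have hI₁0 : 0 ≤ I₁ :=
    setIntegral_nonneg measurableSet_Ioi fun t ht ↦
      (weilArchDensity_pos (zero_lt_one.trans ht)).le
  set L : Set ℝ := {x | a - d₀ < |x| ∧ |x| < a} with hLdef
  have hLm : MeasurableSet L := measurableSet_Ioo.preimage continuous_abs.measurable
  have hFI : Integrable F (volume.prod ν) := by
    rw [integrable_prod_iff hFm]
    constructor
    · -- sections `t ↦ F(x,t)`: integrable on the layer by hypothesis, zero a.e. off it
      filter_upwards [hoff] with x hx
      by_cases hl : a - d₀ < |x| ∧ |x| < a
      · exact (hS x hl.1 hl.2).1.const_mul (w x)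
      · have h0 : w x = 0 := hx hl
        simp only [hF, h0, zero_mul]
        exact integrable_zero _ _ _
    · -- `x ↦ |w x| Φ(x)` is dominated by `(C/2)(w² + 1_L (a − |x|)^{-1/2})`
      set C := 8 + β₀ * (10 + 2 * I₁) with hC
      have hC0 : 0 ≤ C := by positivity
      set g : ℝ → ℝ := fun x ↦
        C / 2 * (w x ^ 2 + L.indicator (fun x ↦ (a - |x|) ^ (-(1 / 2) : ℝ)) x) with hg
      have hgI : Integrable g :=
        (hw.integrable_sq.add
          ((stub_barrierWeakForm_integrableOn_layer hd₀ hd₀a).integrable_indicator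
          hLm)).const_mul (C / 2)
      refine hgI.mono' hFm.norm.integral_prod_right' ?_
      filter_upwards [hoff] with x hx
      rw [Real.norm_of_nonneg (integral_nonneg fun t ↦ norm_nonneg _)]
      have e : ∀ t, ‖F (x, t)‖ =
          |w x| * |(2 * B x - B (x + t) - B (x - t)) * weilArchDensity t| := fun t ↦ by
        simp only [hF]
        rw [Real.norm_eq_abs, abs_mul (w x)]
      rw [integral_congr_ae (Eventually.of_forall e), integral_const_mul]
      by_cases hl : x ∈ L
      · have hΦ := stub_barrierWeakForm_Phi_le hd₀ h2d₀ hB hl.1 hl.2 (hS x hl.1 hl.2).1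
        have hconv := stub_barrierWeakForm_log_le_rpow (d := a - |x|) (β := β₀) (I := I₁)
          (by linarith [hl.2]) (by linarith [hl.1]) hβ₀0 hI₁0
        have hd : 0 < a - |x| := by linarith [hl.2]
        set r := (a - |x|) ^ (-(1 / 4) : ℝ) with hr
        have hr0 : 0 ≤ r := Real.rpow_nonneg hd.le _
        have hr2 : r ^ 2 = (a - |x|) ^ (-(1 / 2) : ℝ) := by
          rw [hr, ← Real.rpow_natCast, ← Real.rpow_mul hd.le]
          norm_num
        have hgx : g x = C / 2 * (w x ^ 2 + r ^ 2) := by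
          simp only [hg, indicator_of_mem hl, hr2]
        rw [hgx]
        calc |w x| * ∫ t in Ioi (0 : ℝ), |(2 * B x - B (x + t) - B (x - t)) * weilArchDensity t|
            ≤ |w x| * (C * r) := mul_le_mul_of_nonneg_left (hΦ.trans hconv) (abs_nonneg _)
          _ ≤ C / 2 * (w x ^ 2 + r ^ 2) := by
              nlinarith [mul_nonneg hC0 (sq_nonneg (|w x| - r)), sq_abs (w x)]
      · have h0 : w x = 0 := hx hl
        have hgx : g x = C / 2 * (w x ^ 2 + 0) := by
          simp only [hg, indicator_of_notMem hl]
        rw [hgx, h0]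
        simp only [abs_zero, zero_mul]
        positivity
  -- Fubini
  have hswap : ∫ t, ∫ x, F (x, t) ∂volume ∂ν = ∫ x, ∫ t, F (x, t) ∂ν ∂volume := by
    rw [← integral_prod_symm F hFI, integral_prod F hFI]
  have hR : ∀ t, weilArchDensity t * ∫ x, (B (x + t) - B x) * (w (x + t) - w x) =
      ∫ x, F (x, t) := by
    intro t
    rw [stub_barrierWeakForm_perT hBm (β := β₀) (fun x ↦ ?_) hwI t, ← integral_const_mul]
    · congr 1
      funext x
      simp only [hF]
      ring
    · rw [abs_of_nonneg (hBb x).1]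
      exact (hBb x).2
  have hL : ∀ x, ∫ t, F (x, t) ∂ν =
      w x * ∫ t in Ioi 0, (2 * B x - B (x + t) - B (x - t)) * weilArchDensity t := by
    intro x
    simp only [hF]
    exact integral_const_mul _ _
  calc c * ∫ x, w x = ∫ x, c * w x := (integral_const_mul _ _).symm
    _ ≤ ∫ x, ∫ t, F (x, t) ∂ν := by
        refine integral_mono_ae (hwI.const_mul c) hFI.integral_prod_left ?_
        filter_upwards [hw0, hoff] with x h0 hx
        rw [hL x]
        by_cases hl : a - d₀ < |x| ∧ |x| < a
        · calc c * w x = w x * c := mul_comm _ _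
            _ ≤ _ := mul_le_mul_of_nonneg_left (hS x hl.1 hl.2).2 h0
        · simp [hx hl]
    _ = ∫ t, ∫ x, F (x, t) ∂volume ∂ν := hswap.symm
    _ = ∫ t in Ioi (0 : ℝ), weilArchDensity t *
          ∫ x, (B (x + t) - B x) * (w (x + t) - w x) :=
        integral_congr_ae (Eventually.of_forall fun t ↦ (hR t).symm)

end Summit.RiemannHypothesis.RiemannHypothesis.Theorems.WeilWindowFlowWindowLipschitz

end
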